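import Summits.KontsevichZagierPeriods.KontsevichZagierPeriods.Theses.DimensionBudget
import Summits.KontsevichZagierPeriods.KontsevichZagierPeriods.Theses.LiftingCriteria
import Literature.NumberTheory.Transcendental.KZRelationsLE
import Literature.NumberTheory.Transcendental.KZCubicalCalculus

/-!
# Route DimensionBudget — split of the deciding crux `BudgetThesis` (stmt-KontsevichZagierPeriods-3748)

Support file (`--supports stmt-KontsevichZagierPeriods-3748`) for the BC2 redirect of the RESTATED
deciding crux `BudgetThesis` of route `route-KontsevichZagierPeriods-DimensionBudget` (the budgeted
two-representation form of Conjecture 1, equivalent to the summit by exhaustion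
`KZ.relations_eq_iSup_relationsLE`). It PROVES the assembly of the typed decomposition

  `CubeNashNormalForm → CubicalKernelWithinOne → BudgetThesis`     (`budgetThesis_of_subs`)

whose two pieces are

* `CubeNashNormalForm` — VERBATIM the shared item stmt-KontsevichZagierPeriods-3574
  (`LiftingCriteria.CubeNashNormalForm`, by `Iff.rfl`: `cubeNashNormalForm_iff`): every difference of
  KZ-rational representations is, modulo `KZ.relations`, a `ℤ`-combination of cube–Nash representations
  (domain the closed unit cube, integrand agreeing on the cube with a `ℚ`-semialgebraic function
  real-analytic on a neighbourhood of it). Compilation by semialgebraic geometry, no transcendence; the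
  tree has it for cubes of dimension `≤ 2` (`LiftingCriteriaCubeNashNormalForm*.lean`), the general case
  is embedded resolution over `ℝ` realised by moves.
* `CubicalKernelWithinOne` — the route's own budget statement on the cubical sector: a `ℤ`-combination of
  TAME cube representations (`KZ.IntegralRep.IsTameCube`) of dimensions `≤ K` that evaluates to `0` is a
  truncated relation INSIDE dimension `K + 1` (`KZ.relationsLE (K + 1)`): Kontsevich–Zagier's Conjecture 1
  on Ayoub's cubical presentation together with the route's answer "one extra variable suffices" to the
  question of [Ayoub 2015, Rem. 1.2 / Rem. 1.5] on the number of variables a rules-proof needs.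

and the move-level lemma gluing them: a cube–Nash representation differs from the tame cube
representation of its Nash extension by a truncated relation inside its own dimension
(`exists_isTameCube_sub_mem_relationsLE`, two integrand-additivity instances).

Nothing here closes an item; the two pieces become the route's leaves by `route edit --split`.

References: M. Kontsevich, D. Zagier, *Periods* (2001), §1.2 (rules (1)–(3), Conjecture 1, Problem 2);
J. Ayoub, *Une version relative de la conjecture des périodes de Kontsevich–Zagier*, Ann. of Math. 181
(2015), Rem. 1.2, Rem. 1.5; J. Ayoub, EMS Newsletter 91 (2014), §2.2 (compact presentation by cubes).
-/

noncomputable section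

open Literature.NumberTheory.Transcendental

namespace Summit.KontsevichZagierPeriods.DimensionBudget.BudgetThesisSplit

/-- **Piece 1, `CubeNashNormalForm`** — verbatim the shared item stmt-KontsevichZagierPeriods-3574
(`LiftingCriteria.CubeNashNormalForm`): every difference `[r] − [r']` of KZ-rational representations
is, modulo `KZ.relations`, a `ℤ`-combination of cube–Nash representations.
[Kontsevich–Zagier 2001, §1.2; Ayoub 2014, §2.2] -/
def CubeNashNormalForm : Prop :=
  ∀ (k k' : ℕ) (r : Literature.NumberTheory.Transcendental.KZ.IntegralRep k) (r' : Literature.NumberTheory.Transcendental.KZ.IntegralRep k'), r.IsRational → r'.IsRational → ∃ (S : ℕ) (n : Fin S → ℕ) (g : (i : Fin S) → (Fin (n i) → ℝ) → ℝ) (U : (i : Fin S) → Set (Fin (n i) → ℝ)) (ε : Fin S → ℤ) (s : (i : Fin S) → Literature.NumberTheory.Transcendental.KZ.IntegralRep (n i)), (∀ i, IsOpen (U i) ∧ Set.pi Set.univ (fun _ : Fin (n i) => Set.Icc (0:ℝ) 1) ⊆ (U i) ∧ Literature.NumberTheory.Transcendental.IsSemialgebraicFunOn ℚ (U i) (g i)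 ∧ AnalyticOnNhd ℝ (g i) (U i)) ∧ (∀ i, (s i).domain = Set.pi Set.univ (fun _ : Fin (n i) => Set.Icc (0:ℝ) 1) ∧ ∀ z ∈ Set.pi Set.univ (fun _ : Fin (n i) => Set.Icc (0:ℝ) 1), (s i).integrand z = g i z) ∧ Literature.NumberTheory.Transcendental.KZ.of r - Literature.NumberTheory.Transcendental.KZ.of r' - ∑ i, ε i • Literature.NumberTheory.Transcendental.KZ.of (s i) ∈ Literature.NumberTheory.Transcendental.KZ.relations

/-- **Piece 2, `CubicalKernelWithinOne`** — the cubical kernel closes inside one extra dimension: for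
every `K`, every `ℤ`-combination of tame cube representations of dimensions `≤ K` with value `0` lies in
the truncated relations `KZ.relationsLE (K + 1)` (moves among representations of dimension `≤ K + 1`).
[Kontsevich–Zagier 2001, §1.2 Conjecture 1 and Problem 2; Ayoub 2015, Rem. 1.2 and Rem. 1.5] -/
def CubicalKernelWithinOne : Prop :=
  ∀ (K : ℕ) (x : Literature.NumberTheory.Transcendental.KZ.FormalRep), x ∈ AddSubgroup.closure {y : Literature.NumberTheory.Transcendental.KZ.FormalRep | ∃ (j : ℕ) (t : Literature.NumberTheory.Transcendental.KZ.IntegralRep j), j ≤ K ∧ (t.domain = {z : Fin j → ℝ | ∀ i, 0 ≤ z i ∧ z i ≤ 1} ∧ AnalyticOnNhd ℝ t.integrand {z : Fin j → ℝ | ∀ i, 0 ≤ z i ∧ z i ≤ 1}) ∧ y = Literature.NumberTheory.Transcendental.KZ.of t} → Literature.NumberTheory.Transcendental.KZ.eval x = 0 → x ∈ Literature.NumberTheory.Transcendental.KZ.relationsLE (K + 1)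

/-- Piece 1 is literally the LiftingCriteria item (shared crux stmt-KontsevichZagierPeriods-3574).
[folklore] -/
theorem cubeNashNormalForm_iff : CubeNashNormalForm ↔
    Summit.KontsevichZagierPeriods.KontsevichZagierPeriods.Theses.LiftingCriteria.CubeNashNormalForm :=
  Iff.rfl

/-- Piece 2 written with the tree's `KZ.IntegralRep.IsTameCube` (the filed statement inlines its two
conjuncts, exactly as the cubical families of `KZCubicalCalculus.lean` do). [folklore] -/
theorem cubicalKernelWithinOne_iff : CubicalKernelWithinOne ↔
    ∀ (K : ℕ) (x : KZ.FormalRep), x ∈ AddSubgroup.closure {y : KZ.FormalRep | ∃ (j : ℕ) (t : KZ.IntegralRep j),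
      j ≤ K ∧ t.IsTameCube ∧ y = KZ.of t} → KZ.eval x = 0 → x ∈ KZ.relationsLE (K + 1) :=
  Iff.rfl

/-- **Tame-ification inside the same dimension.** A cube–Nash representation `s` (domain the closed
unit cube written `Set.pi univ (Icc 0 1)`, integrand agreeing ON THE CUBE with a function `g` that is
`ℚ`-semialgebraic and real-analytic on a neighbourhood `U` of the cube) differs from the tame cube
representation `[[0,1]^j, g]` by a truncated relation inside dimension `j`: one integrand-additivity
instance `[s] − [t] − [z]` with `z = (cube, 0)` (`s.integrand = g + 0` on the cube) minus the instance
`[z] − [z] − [z]` (`0 = 0 + 0`). [Kontsevich–Zagier 2001, §1.2 rule (1)] -/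
theorem exists_isTameCube_sub_mem_relationsLE {j : ℕ} (s : KZ.IntegralRep j) (g : (Fin j → ℝ) → ℝ)
    (U : Set (Fin j → ℝ)) (hsub : Set.pi Set.univ (fun _ : Fin j => Set.Icc (0:ℝ) 1) ⊆ U)
    (hsa : IsSemialgebraicFunOn ℚ U g) (han : AnalyticOnNhd ℝ g U)
    (hdom : s.domain = Set.pi Set.univ (fun _ : Fin j => Set.Icc (0:ℝ) 1))
    (hint : ∀ z ∈ Set.pi Set.univ (fun _ : Fin j => Set.Icc (0:ℝ) 1), s.integrand z = g z) :
    ∃ t : KZ.IntegralRep j, t.IsTameCube ∧ KZ.of s - KZ.of t ∈ KZ.relationsLE j := by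
  have hcube : KZ.cube j = Set.pi Set.univ (fun _ : Fin j => Set.Icc (0:ℝ) 1) := KZ.cube_eq_pi j
  have hsubc : KZ.cube j ⊆ U := fun x hx => hsub (hcube ▸ hx)
  have hg_an : AnalyticOnNhd ℝ g (KZ.cube j) := han.mono hsubc
  have hg_sa : IsSemialgebraicFunOn ℚ (KZ.cube j) g := hsa.mono hsubc KZ.isSemialgebraic_cube
  -- the tame representation `[[0,1]^j, g]`
  obtain ⟨t, ht, htdom, htint⟩ : ∃ t : KZ.IntegralRep j, t.IsTameCube ∧ t.domain = KZ.cube j ∧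
      t.integrand = g :=
    ⟨KZ.IntegralRep.tameCube g hg_an hg_sa, KZ.IntegralRep.isTameCube_tameCube g hg_an hg_sa, rfl, rfl⟩
  -- the zero representation on the same domain
  obtain ⟨z, hzdom, hzint⟩ : ∃ z : KZ.IntegralRep j, z.domain = s.domain ∧ z.integrand = 0 :=
    ⟨{ domain := s.domain
       integrand := 0
       isSemialgebraic_domain := s.isSemialgebraic_domain
       isSemialgebraicFunOn_integrand :=
         (isSemialgebraicFunOn_aeval s.isSemialgebraic_domain 0).congr fun x _ => by simp
       integrableOn := MeasureTheory.integrableOn_zero }, rfl, rfl⟩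
  refine ⟨t, ht, ?_⟩
  -- move (1b): `[s] − [t] − [z]` is an integrand-additivity instance (`f = g + 0` on the cube)
  have h1 : KZ.of s - KZ.of t - KZ.of z ∈ KZ.integrandAddRel := by
    refine ⟨j, s, t, z, by rw [htdom, hdom, hcube], hzdom, fun x hx => ?_, rfl⟩
    rw [Pi.add_apply, htint, hzint, Pi.zero_apply, add_zero]
    exact hint x (hdom ▸ hx)
  -- move (1b): `[z] − [z] − [z]` (`0 = 0 + 0`)
  have h2 : KZ.of z - KZ.of z - KZ.of z ∈ KZ.integrandAddRel :=
    ⟨j, z, z, z, rfl, rfl, fun x _ => by rw [Pi.add_apply, hzint, Pi.zero_apply, add_zero], rfl⟩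
  -- both instances are supported in dimension `≤ j`
  have hmem : ∀ u : KZ.IntegralRep j, KZ.of u ∈ KZ.formalRepLE j := fun u =>
    KZ.of_mem_formalRepLE u le_rfl
  have h1' : KZ.of s - KZ.of t - KZ.of z ∈ KZ.relationsLE j :=
    KZ.movesLE_subset_relationsLE j
      ⟨Or.inl (Or.inl (Or.inr h1)), sub_mem (sub_mem (hmem s) (hmem t)) (hmem z)⟩
  have h2' : KZ.of z - KZ.of z - KZ.of z ∈ KZ.relationsLE j :=
    KZ.movesLE_subset_relationsLE j
      ⟨Or.inl (Or.inl (Or.inr h2)), sub_mem (sub_mem (hmem z) (hmem z)) (hmem z)⟩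
  have e : KZ.of s - KZ.of t = (KZ.of s - KZ.of t - KZ.of z) - (KZ.of z - KZ.of z - KZ.of z) := by
    abel
  rw [e]
  exact sub_mem h1' h2'

/-- **Assembly of the split of `BudgetThesis`** (crux stmt-KontsevichZagierPeriods-3748 of route
DimensionBudget): `CubeNashNormalForm → CubicalKernelWithinOne → BudgetThesis`.
Given KZ-rational `r`, `r'` with equal values: compile `[r] − [r']` to a `ℤ`-combination `x` of
cube–Nash representations (`CubeNashNormalForm`); replace each by its tame version inside its own
dimension (`exists_isTameCube_sub_mem_relationsLE`), getting `y` in the tame cubical span of dimension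
`≤ K` (the top dimension of the cubes) with `x − y ∈ relationsLE K`; by soundness of the calculus
(`KZ.relations_le_ker_eval_holds`) `eval y = eval x = eval ([r] − [r']) = 0`; the cubical kernel budget
puts `y` in `relationsLE (K + 1)`; exhaustion (`KZ.mem_relations_iff_exists_mem_relationsLE`) puts the
compilation relation in some `relationsLE d₁`; monotonicity gives `[r] − [r'] ∈ relationsLE (max d₁ (K+1))`,
which is `BudgetThesis` (its inlined truncation is `KZ.relationsLE` by `rfl`).
[Kontsevich–Zagier 2001, §1.2; Ayoub 2015, Rem. 1.2 and Rem. 1.5] -/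
theorem budgetThesis_of_subs (h₁ : CubeNashNormalForm) (h₂ : CubicalKernelWithinOne) :
    Summit.KontsevichZagierPeriods.KontsevichZagierPeriods.Theses.DimensionBudget.BudgetThesis := by
  intro n m r r' hr hr' hv
  obtain ⟨S, nn, g, U, ε, s, hgen, hs, hrel⟩ := h₁ n m r r' hr hr'
  -- tame versions of the compiled cube–Nash representations, one move (1b) away in their own dimension
  have htame : ∀ i, ∃ t : KZ.IntegralRep (nn i), t.IsTameCube ∧
      KZ.of (s i) - KZ.of t ∈ KZ.relationsLE (nn i) := fun i =>
    exists_isTameCube_sub_mem_relationsLE (s i) (g i) (U i) (hgen i).2.1 (hgen i).2.2.1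
      (hgen i).2.2.2 (hs i).1 (hs i).2
  choose t ht hst using htame
  -- the top dimension of the cubes, the compiled combination `x` and its tame version `y`
  set K : ℕ := Finset.univ.sup nn with hK
  set x : KZ.FormalRep := ∑ i, ε i • KZ.of (s i) with hx
  set y : KZ.FormalRep := ∑ i, ε i • KZ.of (t i) with hy
  -- (1) `y` lies in the tame cubical span of dimension `≤ K`
  have hymem : y ∈ AddSubgroup.closure {w : KZ.FormalRep | ∃ (j : ℕ) (u : KZ.IntegralRep j),
      j ≤ K ∧ u.IsTameCube ∧ w = KZ.of u} := by
    refine AddSubgroup.sum_mem _ fun i _ => AddSubgroup.zsmul_mem _ (AddSubgroup.subset_closure ?_) _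
    exact ⟨nn i, t i, Finset.le_sup (Finset.mem_univ i), ht i, rfl⟩
  -- (2) `x − y` is a truncated relation inside dimension `K`
  have hxy : x - y ∈ KZ.relationsLE K := by
    rw [hx, hy, ← Finset.sum_sub_distrib]
    refine AddSubgroup.sum_mem _ fun i _ => ?_
    rw [← zsmul_sub]
    exact AddSubgroup.zsmul_mem _ (KZ.relationsLE_mono (Finset.le_sup (Finset.mem_univ i)) (hst i)) _
  -- (3) soundness of the calculus: `x`, hence `y`, evaluates to `0`
  have hker : KZ.relations ≤ KZ.eval.ker := KZ.relations_le_ker_eval_holds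
  have h0 : KZ.eval (KZ.of r - KZ.of r' - x) = 0 := AddMonoidHom.mem_ker.mp (hker hrel)
  have hrr' : KZ.eval (KZ.of r - KZ.of r') = 0 := by
    rw [map_sub, KZ.eval_of, KZ.eval_of, hv, sub_self]
  have hx0 : KZ.eval x = 0 := by
    rw [map_sub, hrr', zero_sub, neg_eq_zero] at h0
    exact h0
  have hxy0 : KZ.eval (x - y) = 0 :=
    AddMonoidHom.mem_ker.mp (hker (KZ.relationsLE_le_relations K hxy))
  have hy0 : KZ.eval y = 0 := by
    rw [map_sub, hx0, zero_sub, neg_eq_zero] at hxy0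
    exact hxy0
  -- (4) the route's budget statement on the cubical sector
  have hy1 : y ∈ KZ.relationsLE (K + 1) := h₂ K y hymem hy0
  -- (5) exhaustion for the compilation relation, then monotonicity of the truncation
  obtain ⟨d₁, hd₁⟩ := KZ.mem_relations_iff_exists_mem_relationsLE.mp hrel
  refine ⟨max d₁ (K + 1), ?_⟩
  change KZ.of r - KZ.of r' ∈ KZ.relationsLE (max d₁ (K + 1))
  have e : KZ.of r - KZ.of r' = (KZ.of r - KZ.of r' - x) + (x - y) + y := by abel
  rw [e]
  exact add_mem (add_mem (KZ.relationsLE_mono (le_max_left _ _) hd₁)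
    (KZ.relationsLE_mono ((Nat.le_succ K).trans (le_max_right _ _)) hxy))
    (KZ.relationsLE_mono (le_max_right _ _) hy1)


/-- The same assembly with piece 1 named by its home decl `LiftingCriteria.CubeNashNormalForm`
(shared item stmt-KontsevichZagierPeriods-3574). [Kontsevich–Zagier 2001, §1.2] -/
theorem budgetThesis_of_cubeNashNormalForm_of_cubicalKernelWithinOne
    (h₁ : Summit.KontsevichZagierPeriods.KontsevichZagierPeriods.Theses.LiftingCriteria.CubeNashNormalForm)
    (h₂ : CubicalKernelWithinOne) :
    Summit.KontsevichZagierPeriods.KontsevichZagierPeriods.Theses.DimensionBudget.BudgetThesis :=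
  budgetThesis_of_subs h₁ h₂

end Summit.KontsevichZagierPeriods.DimensionBudget.BudgetThesisSplit

end
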